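import Summits.BirchSwinnertonDyer.Rank1Residual.X11b.MaxUnramifiedRestriction
import Literature.NumberTheory.GaloisCohomology.CyclicClassLocalArtinSymbolSideConditions
import Literature.NumberTheory.GaloisRepresentations.ContinuousH1ResCocycle
import HarnessLib

/-!
# Poitou–Tate toolkit (μₙ-case, 1/·): the class of a cyclic character is UNRAMIFIED at the finite
# places where the character kills the inertia group

Seat `bsd-schneider-door-c6`, gen 6 (cell `bsd-schneider-ideate`; crux `AnticycControlAdditiveK`,
stmt-BirchSwinnertonDyer-19295).  THEOREMS ONLY (no definition, no named fact, no `sorry`).  HONEST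
FRAMING: proves no case of Poitou–Tate duality for a general module and no case of BSD; it is node D2 of
the assembly of the `μₙ`-case of Milne *ADT* I Thm. 4.10(b) `Ker γ¹ ⊆ Im β¹` (FINDING door-c6 g6 §4).

For a number field `K`, `n ≥ 1`, a cyclic character `ψ : Γ_K ↠ ℤ/n` and its class
`[ψ] = oneCocycleClass (scalarCocycle ψ) ∈ H¹(Γ_K, μₙ^D)` (`μₙ^D = Hom(μₙ, μₙ)`, trivial action):

* `localization_oneCocycleClass_scalarCocycle_mem_unramifiedSubgroup` — if `ψ ∘ res_w` kills the
  inertia group `absInertia (K_w)` of `Γ_{K_w}`, then `loc_w [ψ] ∈ H¹_ur(K_w, μₙ^D)`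
  (`DiscreteGaloisModule.unramifiedSubgroup`, the local condition «unramified» of the tree's
  Poitou–Tate statement): the restricted cocycle `σ ↦ ψ(res_w σ)·id` vanishes on `I_{K_w}`, and a class
  is unramified iff its cocycle is principal on the inertia group
  (`LocBridge.mem_unramifiedSubgroup_one_iff_exists`, Milne I §2).
* `localization_oneCocycleClass_scalarCocycle_mem_unramifiedSubgroup_of_forall_localUnits` — the same
  with the hypothesis in class-field form: `ker ψ = Gal(K̄/L)` and `ψ_{L|K}` kills `⟨𝒪_wˣ⟩`
  (inertia ↦ units under THE local Artin map, `artinIdeleMap_localUnits_canonicalArtin_eq_inv`).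

References: [MilneADT2006] I §2 (unramified cohomology), I Thm. 4.10; [NeukirchANT1999] VI (5.6).
-/

noncomputable section

open CategoryTheory Function NumberField IsDedekindDomain Field ValuativeRel
open scoped NumberField

set_option linter.dupNamespace false

namespace Summit.BirchSwinnertonDyer.BirchSwinnertonDyer.Theorems.SchneiderFreeAdditiveX3.PoitouTateReduction

open _root_.ContinuousCohomology
open Literature.NumberTheory.GaloisRepresentations
open Literature.NumberTheory.GaloisRepresentations.DiscreteGaloisModule
open Literature.NumberTheory.GaloisRepresentations.IsNonarchimedeanLocalField
open Literature.NumberTheory.GaloisCohomology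
open Literature.NumberTheory.NumberFields
open Literature.AnabelianGeometry.AbsoluteAnabelian
open Literature.AnabelianGeometry.AbsoluteAnabelian.Prop121vii
open Summit.BirchSwinnertonDyer.Rank1Residual.X11b

variable {K : Type} [Field K] [NumberField K] {n : ℕ} [NeZero n]

/-- **`loc_w [ψ] ∈ H¹_ur(K_w, μₙ^D)` when `ψ` kills the inertia group of `Γ_{K_w}`** (Milne I §2: a
class of a module with trivial inertia action is unramified iff its cocycle vanishes on inertia; here the
cocycle is `σ ↦ ψ(res_w σ)·id`). [cite: MilneADT2006, Ch. I §2 (unramified cohomology)] -/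
theorem localization_oneCocycleClass_scalarCocycle_mem_unramifiedSubgroup
    (ψ : CyclicCharacter (absoluteGaloisGroup K) n) (w : HeightOneSpectrum (𝓞 K))
    (hψ : ∀ σ ∈ absInertia (w.adicCompletion K), ψ (absGaloisRestrict K (w.adicCompletion K) σ) = 0) :
    galoisCohomology.localization ((mu K n).tateDual n) (Sum.inr w) 1
        (oneCocycleClass _ (scalarCocycle ψ)) ∈
      unramifiedSubgroup (GaloisRep.toLocal w ((mu K n).tateDual n)) 1 := by
  change galoisCohomology.res ((mu K n).tateDual n) (w.adicCompletion K) 1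
      (oneCocycleClass _ (scalarCocycle ψ)) ∈
    unramifiedSubgroup (GaloisRep.toLocal w ((mu K n).tateDual n)) 1
  rw [galoisCohomology.res_oneCocycleClass]
  refine (LocBridge.mem_unramifiedSubgroup_one_iff_exists
    (GaloisRep.toLocal w ((mu K n).tateDual n)) _).mpr ⟨0, fun τ hτ => ?_⟩
  rw [galoisCohomology.pullback_absGaloisRestrict_apply, map_zero, sub_zero]
  change scalarEnd K (ψ (absGaloisRestrict K (w.adicCompletion K) τ)) = 0
  rw [hψ τ hτ, scalarEnd_zero]

/-- **Class-field form**: if `ker ψ = Gal(K̄/L)` and the Artin map `ψ_{L|K}` kills the local units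
`⟨u⟩_w`, `u ∈ 𝒪_wˣ`, then `loc_w [ψ]` is unramified — an inertia element `σ = w' ∈ I ≤ W_{K_w}` has
`Art_w w' ∈ 𝒪_wˣ` and `ψ_{L|K}⟨Art_w w'⟩_w = ((res w')|_L)⁻¹`, so `ψ(res σ) = 0`.
[cite: MilneADT2006, Ch. I §2 (unramified cohomology)] [cite: NeukirchANT1999, Ch. VI §5 Prop. (5.6)] -/
theorem localization_oneCocycleClass_scalarCocycle_mem_unramifiedSubgroup_of_forall_localUnits
    (L : IntermediateField K (AlgebraicClosure K)) [FiniteDimensional K L] [IsAbelianGalois K L]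
    [NumberField L] (ψ : CyclicCharacter (absoluteGaloisGroup K) n)
    (hker : ψ.ker = LocalWeilDatum.galFixing K L) (w : HeightOneSpectrum (𝓞 K))
    (hunits : ∀ u : (w.adicCompletion K)ˣ, Valued.v (u : w.adicCompletion K) = 1 →
      artinIdeleMap L artinReciprocity_character_holds (localUnits w u) = 1) :
    galoisCohomology.localization ((mu K n).tateDual n) (Sum.inr w) 1
        (oneCocycleClass _ (scalarCocycle ψ)) ∈
      unramifiedSubgroup (GaloisRep.toLocal w ((mu K n).tateDual n)) 1 := by
  refine localization_oneCocycleClass_scalarCocycle_mem_unramifiedSubgroup ψ w fun σ hσ => ?_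
  set F := w.adicCompletion K with hF
  have ha := isLocalArtinMap_canonicalArtin_holds F
  set i : WeilGroup F := WeilGroup.mk σ ⟨0, isFrobPow_zero_iff_mem_absInertia.mpr hσ⟩ with hi_def
  have hiσ : WeilGroup.toAbsGalois F i = σ := WeilGroup.toAbsGalois_mk _ _
  have hi : i ∈ WeilGroup.inertia F := by rw [WeilGroup.mem_inertia_iff, hiσ]; exact hσ
  have hunit : valuation F (canonicalArtin F i : F) = 1 := by
    have hmem : canonicalArtin F i ∈ (valuation F).valuationSubring.unitGroup := by
      rw [← ha.image_inertia]; exact Subgroup.mem_map_of_mem _ hi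
    exact (Valuation.mem_unitGroup_iff _ _ _).mp hmem
  have hle : ∀ a b : F, valuation F a ≤ valuation F b ↔ Valued.v a ≤ Valued.v b := fun a b =>
    (Valuation.vle_iff_le (valuation F)).symm.trans (Valuation.vle_iff_le Valued.v)
  have hunit' : Valued.v (canonicalArtin F i : F) = 1 := by
    refine le_antisymm ?_ ?_
    · rw [← (Valued.v : Valuation F (WithZero (Multiplicative ℤ))).map_one, ← hle, (valuation F).map_one,
        hunit]
    · rw [← (Valued.v : Valuation F (WithZero (Multiplicative ℤ))).map_one, ← hle, (valuation F).map_one,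
        hunit]
  have h1 := hunits (canonicalArtin F i) hunit'
  rw [artinIdeleMap_localUnits_canonicalArtin_eq_inv L i, inv_eq_one, hiσ, absRestrictNormalHom_eq_one_iff]
    at h1
  have h2 : absGaloisRestrict K F σ ∈ ψ.ker := by rw [hker]; exact h1
  exact (CyclicCharacter.mem_ker _).mp h2

end Summit.BirchSwinnertonDyer.BirchSwinnertonDyer.Theorems.SchneiderFreeAdditiveX3.PoitouTateReduction

end
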